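import Summits.BirchSwinnertonDyer.Rank1Residual.Iwasawa.LambdaInvariantValuationOmega
import Summits.BirchSwinnertonDyer.Rank1Residual.Additive.MazurTateDivisibilityThree
import Summits.BirchSwinnertonDyer.Rank1Residual.Additive.OmegaDvdMazurTateAddvHolds
import HarnessLib

/-!
# (T8-i, λ-form) `λ(Θ) ≥ 3^{n−1}` for every integral model of a SCALED Mazur–Tate element at an
# ADDITIVE prime `3` — the node `Additive.LambdaLowerBoundAdditiveThree` DERIVED in the kernel from
# the divisibility `ω_{n−1} ∣ θ_n` (cell `b2b-bsdres`, lane CLASS-CLOSURE, Additive / O6 Mazur–Tate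
# tower algebra; seat x11b3-p3 GEN 15 under the x11b3 pool rule P-POOL R12-38 (b) — 'pool, record
# only' on the x11b3 side; the owning lane's (cc-typer-5 / o6-r1 / o5-r1) reading governs; THEOREMS ONLY)

HONEST FRAMING (cell `b2b-bsdres`, verbatim in every file): the goal of the cell is to DELETE the
COMBINATION-SHAPED residual classes of the Birch–Swinnerton-Dyer formula for ALL analytic-rank `≤ 1`
elliptic curves over `ℚ` — "full BSD formula for every rank `≤ 1` curve in class `C`" assembled
STRICTLY from published theorems — so that the rank-`≤ 1` remainder becomes exactly the
CONSTRUCTION-SHAPED classes, which are TYPED (missing-input `Prop`s), NOT attempted. This is not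
"finishing BSD". THEOREMS ONLY (pure `p`-adic algebra in `Λ = ℤ_p⟦T⟧` + two one-line bridges); no
definition, no named fact, no `sorry`, no `@[conjecture]`; nothing about any curve is asserted beyond
what the hypotheses say; nothing booked; no label / mark / count changes; census output stays EVIDENCE;
O5 / O6 stay OPEN. The node file `Additive/MazurTateDivisibilityThree.lean` is NOT edited (a
TARGET ↦ THEOREM restamp is the typer's pen).

## What this file proves

The tree's LEMMA A §4 (`Iwasawa.exists_eq_omega_mul_of_omega_dvd_mazurTate`, cc-typer-5 GEN 3) factors an
UNSCALED integral model `Θ ∈ Λ` of `θ_{k+1}` (`ι Θ = θ_{k+1}`) as `Θ = ω_k · U` whenever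
`ω_k ∣ θ_{k+1}` in `ℚ[T]`, whence `λ(Θ) = pᵏ + λ(U) ≥ pᵏ` (Doyon–Lei Cor. 5.3 in the kernel). The
O5 / Additive growth-law nodes are written in the SCALED currency `O5.IsScaledMazurTateLift f n m Θ`
(`ι Θ = 3^m · θ_n`, so that non-integral rows are covered; `λ` is scale-invariant). This file supplies:

* §1 (any prime `p`) the SCALED twin of LEMMA A §4: if `ι Θ = C(p^m) · θ_{k+1}`, `Θ ≠ 0` and
  `ω_k ∣ θ_{k+1}` in `ℚ[T]`, then `Θ = ω_k · U` in `Λ` with `U ≠ 0`, `λ(U) < φ(pᵏ⁺¹)`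
  (`exists_eq_omega_mul_of_omega_dvd_mazurTate_of_eq_C_mul`: truncate `Θ` to a polynomial
  `P ∈ ℤ_p[T]` of degree `< pᵏ⁺¹`, `P ↦ p^m θ_{k+1}` under `ℤ_p[T] → ℚ_p[T]`, and `ω_k`, being MONIC,
  divides `P` already in `ℤ_p[T]` — `Polynomial.map_dvd_map`), hence
  **`pᵏ ≤ λ(Θ) < pᵏ + φ(pᵏ⁺¹)`** (`prime_pow_le_lam_mazurTate_of_omega_dvd_of_eq_C_mul`,
  via `Iwasawa.mu_lam_omega_mul`: `λ(ω_k · U) = pᵏ + λ(U)`).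
* §2 (`p = 3`, the nodes' currency) `O5.IsScaledMazurTateLift f n m Θ`, `Θ ≠ 0`, `1 ≤ n`,
  `ω_{n−1} ∣ θ_n` ⟹ `3^{n−1} ≤ λ(Θ) < 3ⁿ` (`Additive.prime_pow_le_lam_of_isScaledMazurTateLift_of_omega_dvd`),
  with the factorisation `Θ = ω_{n−1}·U`, `μ(Θ) = μ(U)`, `λ(Θ) = 3^{n−1} + λ(U)` (the `θ_n = ω_{n−1} u_n`
  bookkeeping quoted in `O5/O5LayerLaws.lean` §1) and, at layer one, `λ(Θ) ∈ {1, 2}` (the divisibility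
  half of o5-r1's T7; the parity half is NOT touched).
* §3 the UNCONDITIONAL bridges: (T8-i) `Additive.OmegaDvdMazurTateAdditiveThree` ⟹ (T8-i, λ-form)
  `Additive.LambdaLowerBoundAdditiveThree` (`lambdaLowerBoundAdditiveThree_of_omegaDvdMazurTateAdditiveThree`),
  and the same from the node of record `Additive.OmegaDvdMazurTateOfAddv` (every additive prime;
  cc-typer-5 GEN 4's §T dedup bridge `omegaDvdMazurTateAdditiveThree_of_ofAddv` composes)
  (`lambdaLowerBoundAdditiveThree_of_omegaDvdMazurTateOfAddv`). So the λ-form node is no independent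
  obligation: it is DERIVED from `OmegaDvdMazurTateOfAddv` in the kernel, exactly as (T8-i) is.
* §4 END: the node of record is a THEOREM of the tree (`Additive.omegaDvdMazurTateOfAddv_holds`,
  `Additive/OmegaDvdMazurTateAddvHolds.lean`, x11b3-p1 GEN 11 — Doyon–Lei Lemma 5.2 / Cor. 5.3 in the kernel
  from the `U_p`-relation with `a_p = 0`), hence **`lambdaLowerBoundAdditiveThree_holds :
  LambdaLowerBoundAdditiveThree`** UNCONDITIONALLY, together with the binder-free `Addv W 3` readings
  `3^{n−1} ≤ λ(Θ) < 3ⁿ` and, at layer one, `λ(Θ) ∈ {1, 2}`.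

Scope (honest): the λ lower bound `3^{n−1}` is the leading term of `signedBase 3 n`
(`signedBase_eq_leading_add_kuriharaQ`); the sharper `2·3^{n−1}` on the `v₃Δ_min = 9` sector is the
EVIDENCE conjecture (T8-ii) `OmegaSqDvdMazurTateNineThree` / `LambdaLowerBoundNineThree` and is NOT
claimed here; no `μ` statement is made; nothing about BSD_p.
References: [MazurTate1987] B. Mazur, J. Tate, Duke Math. J. 54 (1987) §1; [DoyonLei2021] Lemma 5.2,
Cor. 5.3 [corpus: paper-arxiv-2103.06154 p0009]; [Pollack2003] Def. 6.15, Remark 6.16, Prop. 6.9–6.10;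
[Washington1997] §7.1–7.2 (distinguished polynomials, `μ`/`λ` additivity).
-/

set_option autoImplicit false

noncomputable section

open scoped Classical MatrixGroups ModularForm
open CongruenceSubgroup Polynomial WeierstrassCurve Literature.NumberTheory.EllipticCurves
  Literature.NumberTheory.EllipticCurves.ModularForms
  Literature.NumberTheory.EllipticCurves.Sprung2017
  Literature.NumberTheory.EllipticCurves.Rank1Residual
  Literature.NumberTheory.EllipticCurves.Rank1Residual.Typed
  Summit.BirchSwinnertonDyer.Rank1Residual.X1.MuLambda
  Summit.BirchSwinnertonDyer.Rank1Residual.Supersingular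

namespace Summit.BirchSwinnertonDyer.Rank1Residual.Iwasawa

variable {p : ℕ} [hp : Fact p.Prime]

/-! ## §1. The SCALED twin of LEMMA A §4 (any prime `p`) -/

section Scaled

variable {N : ℕ} {f : CuspForm (Gamma0 N) 2}

/-- If `ι Θ = p^m · θ_{k+1}` then `Θ` has no coefficients in degrees `≥ pᵏ⁺¹` (`deg θ_{k+1} < pᵏ⁺¹`,
Pollack 2003 Def. 6.15 / Rem. 6.16). [cite: Pollack2003, Def. 6.15 and Remark 6.16] -/
theorem coeff_eq_zero_of_iwasawaToPowerSeries_eq_C_mul {k m : ℕ} {Θ : IwasawaAlgebra p}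
    (hΘ : iwasawaToPowerSeries p Θ = PowerSeries.C ((p : ℚ_[p]) ^ m) *
      ((mazurTateElement f p (k + 1)).map (algebraMap ℚ ℚ_[p]) : PowerSeries ℚ_[p]))
    {i : ℕ} (hi : p ^ (k + 1) ≤ i) : PowerSeries.coeff i Θ = 0 := by
  have h := congrArg (PowerSeries.coeff i) hΘ
  rw [iwasawaToPowerSeries, PowerSeries.coeff_map, PowerSeries.coeff_C_mul, Polynomial.coeff_coe,
    Polynomial.coeff_map,
    Polynomial.coeff_eq_zero_of_natDegree_lt
      (lt_of_lt_of_le (natDegree_mazurTateElement_lt f p (k + 1)) hi),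
    map_zero, mul_zero] at h
  exact (injective_iff_map_eq_zero _).mp (IsFractionRing.injective ℤ_[p] ℚ_[p]) _ h

/-- **SCALED LEMMA A §4.** An integral model `Θ ≠ 0` of a SCALED Mazur–Tate element, `ι Θ = p^m · θ_{k+1}`,
with `ω_k ∣ θ_{k+1}` in `ℚ[T]`, factors as `Θ = ω_k · U` in `Λ` with `U ≠ 0` and `λ(U) < φ(pᵏ⁺¹)`:
`Θ` is a polynomial `P ∈ ℤ_p[T]` of degree `< pᵏ⁺¹` mapping to `p^m θ_{k+1}` in `ℚ_p[T]`; `ω_k ∣ p^m θ_{k+1}`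
there, and `ω_k` being monic the divisibility descends to `ℤ_p[T]` (`Polynomial.map_dvd_map`);
`deg U < φ(pᵏ⁺¹)` and `λ ≤ deg`. The unscaled case `m = 0` is the tree's
`exists_eq_omega_mul_of_omega_dvd_mazurTate`. [cite: DoyonLei2021, Lemma 5.2 and Cor. 5.3]
[cite: Pollack2003, Def. 6.15 and Remark 6.16] -/
theorem exists_eq_omega_mul_of_omega_dvd_mazurTate_of_eq_C_mul {k m : ℕ} {Θ : IwasawaAlgebra p}
    (hΘ : iwasawaToPowerSeries p Θ = PowerSeries.C ((p : ℚ_[p]) ^ m) *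
      ((mazurTateElement f p (k + 1)).map (algebraMap ℚ ℚ_[p]) : PowerSeries ℚ_[p]))
    (hΘ0 : Θ ≠ 0) (hω : (cyclotomicOmega p k).map (Int.castRingHom ℚ) ∣ mazurTateElement f p (k + 1)) :
    ∃ U : IwasawaAlgebra p, Θ = toIwasawa p (cyclotomicOmega p k) * U ∧ U ≠ 0 ∧
      lam U < Nat.totient (p ^ (k + 1)) := by
  -- `Θ` is the polynomial `P := trunc_{p^{k+1}} Θ`
  set P : ℤ_[p][X] := PowerSeries.trunc (p ^ (k + 1)) Θ with hP
  have hPΘ : (P : IwasawaAlgebra p) = Θ := by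
    ext i
    rw [Polynomial.coeff_coe, hP, PowerSeries.coeff_trunc]
    split_ifs with hi
    · rfl
    · exact (coeff_eq_zero_of_iwasawaToPowerSeries_eq_C_mul hΘ (not_lt.mp hi)).symm
  -- `P ↦ p^m · θ_{k+1}` under `ℤ_p[T] → ℚ_p[T]`
  have hPmap : P.map (algebraMap ℤ_[p] ℚ_[p]) =
      Polynomial.C ((p : ℚ_[p]) ^ m) * (mazurTateElement f p (k + 1)).map (algebraMap ℚ ℚ_[p]) := by
    ext i
    have h := congrArg (PowerSeries.coeff i) hΘ
    rw [iwasawaToPowerSeries, PowerSeries.coeff_map, PowerSeries.coeff_C_mul, Polynomial.coeff_coe] at h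
    rw [Polynomial.coeff_map, Polynomial.coeff_C_mul, ← h, ← hPΘ, Polynomial.coeff_coe]
  -- the divisibility in `ℚ_p[T]`, then in `ℤ_p[T]` (monic divisor)
  obtain ⟨hmon, hdeg⟩ := monic_map_cyclotomicOmega (p := p) k
  have hdvdQ : ((cyclotomicOmega p k).map (Int.castRingHom ℤ_[p])).map (algebraMap ℤ_[p] ℚ_[p]) ∣
      P.map (algebraMap ℤ_[p] ℚ_[p]) := by
    rw [hPmap, Polynomial.map_map, RingHom.ext_int ((algebraMap ℤ_[p] ℚ_[p]).comp (Int.castRingHom ℤ_[p]))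
      ((algebraMap ℚ ℚ_[p]).comp (Int.castRingHom ℚ)), ← Polynomial.map_map]
    exact Dvd.dvd.mul_left (Polynomial.map_dvd _ hω) _
  have hdvd : (cyclotomicOmega p k).map (Int.castRingHom ℤ_[p]) ∣ P :=
    (Polynomial.map_dvd_map _ (IsFractionRing.injective ℤ_[p] ℚ_[p]) hmon).mp hdvdQ
  obtain ⟨Q, hPQ⟩ := hdvd
  refine ⟨(Q : IwasawaAlgebra p), ?_, ?_, ?_⟩
  · rw [← hPΘ, hPQ, Polynomial.coe_mul, toIwasawa_apply]
  · intro hQ0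
    apply hΘ0
    rw [← hPΘ, hPQ, Polynomial.coe_mul, hQ0, mul_zero]
  · -- degrees: `deg P < p^{k+1}`, `deg P = p^k + deg Q`
    have hQ0 : Q ≠ 0 := by
      rintro rfl
      apply hΘ0
      rw [← hPΘ, hPQ, mul_zero, Polynomial.coe_zero]
    have hQ0' : (Q : IwasawaAlgebra p) ≠ 0 := fun h ↦ hQ0 (Polynomial.coe_eq_zero_iff.mp h)
    have hP0 : P ≠ 0 := by rw [hPQ]; exact mul_ne_zero hmon.ne_zero hQ0
    have hdegP : P.natDegree < p ^ (k + 1) := by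
      have h := PowerSeries.degree_trunc_lt Θ (p ^ (k + 1))
      rw [← hP] at h
      exact (Polynomial.natDegree_lt_iff_degree_lt hP0).mpr h
    have hdegPQ : P.natDegree = p ^ k + Q.natDegree := by
      rw [hPQ, Polynomial.natDegree_mul hmon.ne_zero hQ0, hdeg]
    have hφ : Nat.totient (p ^ (k + 1)) + p ^ k = p ^ (k + 1) := by
      rw [Nat.totient_prime_pow_succ hp.out, ← mul_add_one, Nat.sub_add_cancel hp.out.one_le, pow_succ]
    have hle := lam_coe_le_natDegree hQ0'
    omega

/-- **`pᵏ ≤ λ(Θ) < pᵏ + φ(pᵏ⁺¹)` for an integral model `Θ ≠ 0` of a SCALED `θ_{k+1}` with `ω_k ∣ θ_{k+1}`**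
(Doyon–Lei Cor. 5.3's inequality in the kernel, scaled currency: `λ(Θ) = pᵏ + λ(U)`).
[cite: DoyonLei2021, Lemma 5.2 and Cor. 5.3] -/
theorem prime_pow_le_lam_mazurTate_of_omega_dvd_of_eq_C_mul {k m : ℕ} {Θ : IwasawaAlgebra p}
    (hΘ : iwasawaToPowerSeries p Θ = PowerSeries.C ((p : ℚ_[p]) ^ m) *
      ((mazurTateElement f p (k + 1)).map (algebraMap ℚ ℚ_[p]) : PowerSeries ℚ_[p]))
    (hΘ0 : Θ ≠ 0) (hω : (cyclotomicOmega p k).map (Int.castRingHom ℚ) ∣ mazurTateElement f p (k + 1)) :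
    p ^ k ≤ lam Θ ∧ lam Θ < p ^ k + Nat.totient (p ^ (k + 1)) := by
  obtain ⟨U, hΘU, hU0, hlamU⟩ := exists_eq_omega_mul_of_omega_dvd_mazurTate_of_eq_C_mul hΘ hΘ0 hω
  have hlG := (mu_lam_omega_mul hU0 k).2
  rw [← hΘU] at hlG
  omega

/-- The `μ`-reading of the same factorisation: `μ(Θ) = μ(U)` for `Θ = ω_k · U` (`μ(ω_k) = 0`).
[cite: Washington1997, §7.1–7.2 and Thm. 7.3] -/
theorem exists_eq_omega_mul_mu_eq_of_omega_dvd_mazurTate_of_eq_C_mul {k m : ℕ} {Θ : IwasawaAlgebra p}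
    (hΘ : iwasawaToPowerSeries p Θ = PowerSeries.C ((p : ℚ_[p]) ^ m) *
      ((mazurTateElement f p (k + 1)).map (algebraMap ℚ ℚ_[p]) : PowerSeries ℚ_[p]))
    (hΘ0 : Θ ≠ 0) (hω : (cyclotomicOmega p k).map (Int.castRingHom ℚ) ∣ mazurTateElement f p (k + 1)) :
    ∃ U : IwasawaAlgebra p, Θ = toIwasawa p (cyclotomicOmega p k) * U ∧ U ≠ 0 ∧
      mu Θ = mu U ∧ lam Θ = p ^ k + lam U := by
  obtain ⟨U, hΘU, hU0, -⟩ := exists_eq_omega_mul_of_omega_dvd_mazurTate_of_eq_C_mul hΘ hΘ0 hω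
  obtain ⟨hμ, hl⟩ := mu_lam_omega_mul hU0 k
  exact ⟨U, hΘU, hU0, by rw [hΘU, hμ], by rw [hΘU, hl]⟩

end Scaled

end Summit.BirchSwinnertonDyer.Rank1Residual.Iwasawa

/-! ## §2. `p = 3`, in the currency `O5.IsScaledMazurTateLift` of the O5 / Additive growth-law nodes -/

namespace Summit.BirchSwinnertonDyer.Rank1Residual.Additive

open Summit.BirchSwinnertonDyer.Rank1Residual.Iwasawa

/-- **`3^{n−1} ≤ λ(Θ) < 3ⁿ`** for every integral lift `Θ ≠ 0` of a scaled `θ_n(f)` (`ι Θ = 3^m θ_n`,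
`O5.IsScaledMazurTateLift f n m Θ`), `n ≥ 1`, granted `ω_{n−1} ∣ θ_n` in `ℚ[T]` — any `f ∈ S₂(Γ₀(N))`.
[cite: DoyonLei2021, Lemma 5.2 and Cor. 5.3] -/
theorem prime_pow_le_lam_of_isScaledMazurTateLift_of_omega_dvd {N : ℕ} {f : CuspForm (Gamma0 N) 2}
    {n m : ℕ} {Θ : IwasawaAlgebra 3} (hn : 1 ≤ n) (hΘ : O5.IsScaledMazurTateLift f n m Θ) (hΘ0 : Θ ≠ 0)
    (hω : (cyclotomicOmega 3 (n - 1)).map (Int.castRingHom ℚ) ∣ mazurTateElement f 3 n) :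
    3 ^ (n - 1) ≤ lam Θ ∧ lam Θ < 3 ^ n := by
  obtain ⟨k, rfl⟩ : ∃ k, n = k + 1 := ⟨n - 1, (Nat.sub_add_cancel hn).symm⟩
  have h := prime_pow_le_lam_mazurTate_of_omega_dvd_of_eq_C_mul (p := 3) (f := f) (k := k) (m := m)
    (Θ := Θ) hΘ hΘ0 (by simpa using hω)
  have hφ : Nat.totient (3 ^ (k + 1)) + 3 ^ k = 3 ^ (k + 1) := by
    rw [Nat.totient_prime_pow_succ Nat.prime_three, pow_succ]
    omega
  simp only [Nat.add_sub_cancel]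
  omega

/-- **`Θ = ω_{n−1} · U` with `U ≠ 0`, `μ(Θ) = μ(U)`, `λ(Θ) = 3^{n−1} + λ(U)`** — the `θ_n = ω_{n−1} u_n`
bookkeeping of `O5/O5LayerLaws.lean` §1 ("`λ(θ_n) = 3^{n−1} + λ(u_n)`, `μ(θ_n) = μ(u_n)`") for an integral
lift of a scaled `θ_n`, granted `ω_{n−1} ∣ θ_n`. [cite: MazurTate1987, §1] -/
theorem exists_eq_omega_mul_of_isScaledMazurTateLift_of_omega_dvd {N : ℕ} {f : CuspForm (Gamma0 N) 2}
    {n m : ℕ} {Θ : IwasawaAlgebra 3} (hn : 1 ≤ n) (hΘ : O5.IsScaledMazurTateLift f n m Θ) (hΘ0 : Θ ≠ 0)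
    (hω : (cyclotomicOmega 3 (n - 1)).map (Int.castRingHom ℚ) ∣ mazurTateElement f 3 n) :
    ∃ U : IwasawaAlgebra 3, Θ = toIwasawa 3 (cyclotomicOmega 3 (n - 1)) * U ∧ U ≠ 0 ∧
      mu Θ = mu U ∧ lam Θ = 3 ^ (n - 1) + lam U := by
  obtain ⟨k, rfl⟩ : ∃ k, n = k + 1 := ⟨n - 1, (Nat.sub_add_cancel hn).symm⟩
  simp only [Nat.add_sub_cancel] at hω ⊢
  exact exists_eq_omega_mul_mu_eq_of_omega_dvd_mazurTate_of_eq_C_mul (p := 3) (f := f) (k := k)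
    (m := m) (Θ := Θ) hΘ hΘ0 hω

/-- **Layer one: `λ(Θ) ∈ {1, 2}`** for every integral lift `Θ ≠ 0` of a scaled `θ₁(f)` with `T = ω₀ ∣ θ₁`
— the divisibility half of `O5/O5LayerLaws.lean` T7 ("`θ₁ = T·u₁` with `deg u₁ ≤ 1`, so `λ(θ₁) ∈ {1, 2}`");
which of the two values occurs is the PARITY conjecture T5 / T7 and is NOT touched here.
[cite: MazurTate1987, §1] -/
theorem lam_eq_one_or_two_of_isScaledMazurTateLift_one_of_omega_dvd {N : ℕ} {f : CuspForm (Gamma0 N) 2}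
    {m : ℕ} {Θ : IwasawaAlgebra 3} (hΘ : O5.IsScaledMazurTateLift f 1 m Θ) (hΘ0 : Θ ≠ 0)
    (hω : (cyclotomicOmega 3 0).map (Int.castRingHom ℚ) ∣ mazurTateElement f 3 1) :
    lam Θ = 1 ∨ lam Θ = 2 := by
  have h := prime_pow_le_lam_of_isScaledMazurTateLift_of_omega_dvd (n := 1) le_rfl hΘ hΘ0 hω
  simp only [Nat.sub_self, pow_zero, pow_one] at h
  omega

/-! ## §3. The bridges: (T8-i) ⟹ (T8-i, λ-form); node of record ⟹ (T8-i, λ-form) -/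

/-- **(T8-i) ⟹ (T8-i, λ-form)** (UNCONDITIONAL bridge): `ω_{n−1} ∣ θ_n(f_W)` for every `W` additive at `3`
gives `λ(Θ) ≥ 3^{n−1}` for every integral lift `Θ ≠ 0` of a scaled `θ_n(f_W)` — the node
`LambdaLowerBoundAdditiveThree` of `Additive/MazurTateDivisibilityThree.lean` §3 is DERIVED from (T8-i)
in the kernel (its docstring's route: `Θ = ω_{n−1}·v`, `λ(ω_{n−1}) = 3^{n−1}`, `λ` additive).
[cite: MazurTate1987, §1] [cite: DoyonLei2021, Cor. 5.3] -/
theorem lambdaLowerBoundAdditiveThree_of_omegaDvdMazurTateAdditiveThree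
    (h : OmegaDvdMazurTateAdditiveThree) : LambdaLowerBoundAdditiveThree := by
  intro W _ _ _ f hf hadd n m Θ hn hΘ hΘ0
  exact (prime_pow_le_lam_of_isScaledMazurTateLift_of_omega_dvd hn hΘ hΘ0 (h W f hf hadd n hn)).1

/-- **Node of record ⟹ (T8-i, λ-form)** (UNCONDITIONAL bridge): `Additive.OmegaDvdMazurTateOfAddv`
(Doyon–Lei Lemma 5.2 / Cor. 5.3 at EVERY additive prime, typed p253482) gives
`LambdaLowerBoundAdditiveThree` through cc-typer-5's §T dedup bridge
`omegaDvdMazurTateAdditiveThree_of_ofAddv`. [cite: DoyonLei2021, Lemma 5.2 and Cor. 5.3] -/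
theorem lambdaLowerBoundAdditiveThree_of_omegaDvdMazurTateOfAddv (h : OmegaDvdMazurTateOfAddv) :
    LambdaLowerBoundAdditiveThree :=
  lambdaLowerBoundAdditiveThree_of_omegaDvdMazurTateAdditiveThree
    (omegaDvdMazurTateAdditiveThree_of_ofAddv h)

/-- The two-sided reading granted the node of record: at an additive `3`, `3^{n−1} ≤ λ(Θ) < 3ⁿ` for every
integral lift `Θ ≠ 0` of a scaled `θ_n(f_W)`, `n ≥ 1`. [cite: DoyonLei2021, Lemma 5.2 and Cor. 5.3] -/
theorem prime_pow_le_lam_of_isScaledMazurTateLift_of_addv (h : OmegaDvdMazurTateOfAddv)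
    (W : WeierstrassCurve ℚ) [W.IsElliptic] [W.IsGloballyMinimal] [NeZero (W.conductorNorm ℤ)]
    (f : CuspForm (Gamma0 (W.conductorNorm ℤ)) 2) (hf : IsNewformOf W f) (hadd : Addv W 3)
    {n m : ℕ} {Θ : IwasawaAlgebra 3} (hn : 1 ≤ n) (hΘ : O5.IsScaledMazurTateLift f n m Θ) (hΘ0 : Θ ≠ 0) :
    3 ^ (n - 1) ≤ lam Θ ∧ lam Θ < 3 ^ n :=
  prime_pow_le_lam_of_isScaledMazurTateLift_of_omega_dvd hn hΘ hΘ0 (h W f 3 hf hadd n hn)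

/-- Layer one granted the node of record: at an additive `3`, `λ(Θ) ∈ {1, 2}` for every integral lift
`Θ ≠ 0` of a scaled `θ₁(f_W)` (the divisibility half of `O5/O5LayerLaws.lean` T7, now on `Addv W 3`).
[cite: MazurTate1987, §1] [cite: DoyonLei2021, Cor. 5.3] -/
theorem lam_eq_one_or_two_of_isScaledMazurTateLift_one_of_addv (h : OmegaDvdMazurTateOfAddv)
    (W : WeierstrassCurve ℚ) [W.IsElliptic] [W.IsGloballyMinimal] [NeZero (W.conductorNorm ℤ)]
    (f : CuspForm (Gamma0 (W.conductorNorm ℤ)) 2) (hf : IsNewformOf W f) (hadd : Addv W 3)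
    {m : ℕ} {Θ : IwasawaAlgebra 3} (hΘ : O5.IsScaledMazurTateLift f 1 m Θ) (hΘ0 : Θ ≠ 0) :
    lam Θ = 1 ∨ lam Θ = 2 :=
  lam_eq_one_or_two_of_isScaledMazurTateLift_one_of_omega_dvd hΘ hΘ0 (h W f 3 hf hadd 1 le_rfl)

/-! ## §4. END: (T8-i, λ-form) is a theorem of the tree -/

/-- **(T8-i, λ-form) HOLDS: `Additive.LambdaLowerBoundAdditiveThree` is a THEOREM** — for every `W/ℚ`
additive at `3` with newform `f`, every `n ≥ 1` and every integral lift `Θ ≠ 0` of a scaled `θ_n(f)`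
(`O5.IsScaledMazurTateLift f n m Θ`): `3^{n−1} ≤ λ(Θ)`. Proof: the node of record
`Additive.OmegaDvdMazurTateOfAddv` holds in the kernel (`omegaDvdMazurTateOfAddv_holds`, x11b3-p1 GEN 11:
Doyon–Lei Lemma 5.2 / Cor. 5.3 — `ω_{n−1} ∣ θ_n` from the `U_p`-relation with `a_p(W) = 0`), and §3's bridge.
The binders are the node's, verbatim; no `μ` hypothesis. [cite: DoyonLei2021, Lemma 5.2 and Cor. 5.3]
[cite: MazurTate1987, §1] -/
theorem lambdaLowerBoundAdditiveThree_holds : LambdaLowerBoundAdditiveThree :=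
  lambdaLowerBoundAdditiveThree_of_omegaDvdMazurTateOfAddv omegaDvdMazurTateOfAddv_holds

/-- **`3^{n−1} ≤ λ(Θ) < 3ⁿ` at an additive `3`, UNCONDITIONALLY** (`W` additive at `3`, `f` its newform,
`Θ ≠ 0` an integral lift of a scaled `θ_n(f)`, `n ≥ 1`). [cite: DoyonLei2021, Lemma 5.2 and Cor. 5.3] -/
theorem prime_pow_le_lam_of_isScaledMazurTateLift_of_addv'
    (W : WeierstrassCurve ℚ) [W.IsElliptic] [W.IsGloballyMinimal] [NeZero (W.conductorNorm ℤ)]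
    (f : CuspForm (Gamma0 (W.conductorNorm ℤ)) 2) (hf : IsNewformOf W f) (hadd : Addv W 3)
    {n m : ℕ} {Θ : IwasawaAlgebra 3} (hn : 1 ≤ n) (hΘ : O5.IsScaledMazurTateLift f n m Θ) (hΘ0 : Θ ≠ 0) :
    3 ^ (n - 1) ≤ lam Θ ∧ lam Θ < 3 ^ n :=
  prime_pow_le_lam_of_isScaledMazurTateLift_of_addv omegaDvdMazurTateOfAddv_holds W f hf hadd hn hΘ hΘ0

/-- **`Θ = ω_{n−1}·U`, `U ≠ 0`, `μ(Θ) = μ(U)`, `λ(Θ) = 3^{n−1} + λ(U)` at an additive `3`, UNCONDITIONALLY**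
— the `θ_n = ω_{n−1} u_n` bookkeeping of the O5 / O6 planners for every integral lift of a scaled `θ_n(f_W)`.
[cite: MazurTate1987, §1] [cite: DoyonLei2021, Cor. 5.3] -/
theorem exists_eq_omega_mul_of_isScaledMazurTateLift_of_addv
    (W : WeierstrassCurve ℚ) [W.IsElliptic] [W.IsGloballyMinimal] [NeZero (W.conductorNorm ℤ)]
    (f : CuspForm (Gamma0 (W.conductorNorm ℤ)) 2) (hf : IsNewformOf W f) (hadd : Addv W 3)
    {n m : ℕ} {Θ : IwasawaAlgebra 3} (hn : 1 ≤ n) (hΘ : O5.IsScaledMazurTateLift f n m Θ) (hΘ0 : Θ ≠ 0) :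
    ∃ U : IwasawaAlgebra 3, Θ = toIwasawa 3 (cyclotomicOmega 3 (n - 1)) * U ∧ U ≠ 0 ∧
      mu Θ = mu U ∧ lam Θ = 3 ^ (n - 1) + lam U :=
  exists_eq_omega_mul_of_isScaledMazurTateLift_of_omega_dvd hn hΘ hΘ0
    (omegaDvdMazurTateOfAddv_holds W f 3 hf hadd n hn)

/-- **Layer one at an additive `3`, UNCONDITIONALLY: `λ(Θ) ∈ {1, 2}`** for every integral lift `Θ ≠ 0` of a
scaled `θ₁(f_W)` (divisibility half of o5-r1's T7 on all of `Addv W 3`; the parity half is NOT touched).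
[cite: MazurTate1987, §1] [cite: DoyonLei2021, Cor. 5.3] -/
theorem lam_eq_one_or_two_of_isScaledMazurTateLift_one_of_addv'
    (W : WeierstrassCurve ℚ) [W.IsElliptic] [W.IsGloballyMinimal] [NeZero (W.conductorNorm ℤ)]
    (f : CuspForm (Gamma0 (W.conductorNorm ℤ)) 2) (hf : IsNewformOf W f) (hadd : Addv W 3)
    {m : ℕ} {Θ : IwasawaAlgebra 3} (hΘ : O5.IsScaledMazurTateLift f 1 m Θ) (hΘ0 : Θ ≠ 0) :
    lam Θ = 1 ∨ lam Θ = 2 :=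
  lam_eq_one_or_two_of_isScaledMazurTateLift_one_of_addv omegaDvdMazurTateOfAddv_holds W f hf hadd hΘ hΘ0

end Summit.BirchSwinnertonDyer.Rank1Residual.Additive

end
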